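import Literature.Algebra.Polynomial.CasasAlvero.Heptanomial
import HarnessLib

/-!
# The seven-witness criterion (centred octanomials)

Sequel to `Trinomial.lean`, `Char23Digits.lean` (tetranomials), `Pentanomial.lean`, `Hexanomial.lean` and `Heptanomial.lean`: a centred
octanomial `X^d + s X^m + t X^n + u X^l + v X^j + w X^g + y X^e + z X^c` (`0 < c < e < g < j < l < n < m < d`, `z ≠ 0`) over a field `K`
with `K`-rational roots `ρ, σ, τ, υ, φ, χ, ψ` killing the Hasse derivatives `H_m, H_n, H_l, H_j, H_g, H_e, H_c` respectively is a
Casas-Alvero polynomial (every other index `0 < i < d` is vacuous at the root `0`) and is not a `d`-th power, so `¬ CA_d(K)`; in prime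
characteristic the fourteen conditions are integer congruences — the mechanism of the positive-characteristic counter-examples of
[GvBLSW 2007, §3] (there `X^{p+1} - X^p`, Prop. 7), for sparse centred polynomials with rational witnesses.

Needed from characteristic `907` on, for the digit `9`: the translated–scaled normal form `X^9 + a_7 X^7 + … + a_1 X` of a Casas-Alvero
nonic with `𝔽_p`-rational witnesses has at most seven inner monomials; at `p = 907` the complete rational-witness search finds exactly two
scaling classes, both with the full inner support `{1, …, 7}` (e.g. `X^9 + 351X^7 + 180X^6 + 473X^5 + 406X^4 + 642X^3 + 755X^2 + 820X`),
and none with fewer monomials.  The instances live in the `Degree9Frontier…` / `Char<p>Digits` files. [cite: GrafVonBothmerEtAl2007, §3 (Prop. 7)]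
-/

noncomputable section

open Polynomial

namespace Literature.Algebra.Polynomial.CasasAlvero

section Octanomial

variable {K : Type*} [Field K] {d m n l j g e c : ℕ}

/-- the tail of the centred octanomial has degree `< d`. [cite: GrafVonBothmerEtAl2007, §3 (Prop. 7)] -/
private theorem natDegree_octanom_tail_lt (hce : c < e) (heg : e < g) (hgj : g < j) (hjl : j < l) (hln : l < n) (hnm : n < m) (hmd : m < d)
    (s t u v w y z : K) :
    (s • (X : K[X]) ^ m + t • X ^ n + u • X ^ l + v • X ^ j + w • X ^ g + y • X ^ e + z • X ^ c).natDegree < d := by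
  refine lt_of_le_of_lt (natDegree_add_le _ _) (max_lt ?_ ?_)
  · refine lt_of_le_of_lt (natDegree_add_le _ _) (max_lt ?_ ?_)
    · refine lt_of_le_of_lt (natDegree_add_le _ _) (max_lt ?_ ?_)
      · refine lt_of_le_of_lt (natDegree_add_le _ _) (max_lt ?_ ?_)
        · refine lt_of_le_of_lt (natDegree_add_le _ _) (max_lt ?_ ?_)
          · refine lt_of_le_of_lt (natDegree_add_le _ _) (max_lt ?_ ?_)
            · exact lt_of_le_of_lt (le_trans (natDegree_smul_le _ _) (natDegree_X_pow_le m)) hmd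
            · exact lt_of_le_of_lt (le_trans (natDegree_smul_le _ _) (natDegree_X_pow_le n)) (by omega)
          · exact lt_of_le_of_lt (le_trans (natDegree_smul_le _ _) (natDegree_X_pow_le l)) (by omega)
        · exact lt_of_le_of_lt (le_trans (natDegree_smul_le _ _) (natDegree_X_pow_le j)) (by omega)
      · exact lt_of_le_of_lt (le_trans (natDegree_smul_le _ _) (natDegree_X_pow_le g)) (by omega)
    · exact lt_of_le_of_lt (le_trans (natDegree_smul_le _ _) (natDegree_X_pow_le e)) (by omega)
  · exact lt_of_le_of_lt (le_trans (natDegree_smul_le _ _) (natDegree_X_pow_le c)) (by omega)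

/-- reassociation of the octanomial as `X^d + tail`. [cite: GrafVonBothmerEtAl2007, §3 (Prop. 7)] -/
private theorem octanom_eq (s t u v w y z : K) :
    (X ^ d + s • X ^ m + t • X ^ n + u • X ^ l + v • X ^ j + w • X ^ g + y • X ^ e + z • X ^ c : K[X]) =
      X ^ d + (s • X ^ m + t • X ^ n + u • X ^ l + v • X ^ j + w • X ^ g + y • X ^ e + z • X ^ c) := by
  simp only [add_assoc]

/-- its degree is `d`. [cite: GrafVonBothmerEtAl2007, §3 (Prop. 7)] -/
private theorem natDegree_octanom (hce : c < e) (heg : e < g) (hgj : g < j) (hjl : j < l) (hln : l < n) (hnm : n < m) (hmd : m < d)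
    (s t u v w y z : K) :
    (X ^ d + s • X ^ m + t • X ^ n + u • X ^ l + v • X ^ j + w • X ^ g + y • X ^ e + z • X ^ c : K[X]).natDegree = d := by
  rw [octanom_eq, natDegree_add_eq_left_of_natDegree_lt]
  · exact natDegree_X_pow d
  · rw [natDegree_X_pow]; exact natDegree_octanom_tail_lt hce heg hgj hjl hln hnm hmd s t u v w y z

/-- it is monic. [cite: GrafVonBothmerEtAl2007, §3 (Prop. 7)] -/
private theorem monic_octanom (hce : c < e) (heg : e < g) (hgj : g < j) (hjl : j < l) (hln : l < n) (hnm : n < m) (hmd : m < d)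
    (s t u v w y z : K) :
    (X ^ d + s • X ^ m + t • X ^ n + u • X ^ l + v • X ^ j + w • X ^ g + y • X ^ e + z • X ^ c : K[X]).Monic := by
  have h := natDegree_octanom_tail_lt hce heg hgj hjl hln hnm hmd s t u v w y z
  rw [octanom_eq]
  exact (monic_X_pow d).add_of_left
    (lt_of_le_of_lt degree_le_natDegree (by rw [degree_X_pow]; exact_mod_cast h))

/-- coefficients of the octanomial. [cite: GrafVonBothmerEtAl2007, §3 (Prop. 7)] -/
private theorem coeff_octanom (s t u v w y z : K) (i : ℕ) :
    (X ^ d + s • X ^ m + t • X ^ n + u • X ^ l + v • X ^ j + w • X ^ g + y • X ^ e + z • X ^ c : K[X]).coeff i =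
      (if i = d then 1 else 0) + (if i = m then s else 0) + (if i = n then t else 0) + (if i = l then u else 0) + (if i = j then v else 0) + (if i = g then w else 0) + (if i = e then y else 0) + (if i = c then z else 0) := by
  simp only [coeff_add, coeff_smul, coeff_X_pow, smul_eq_mul, mul_ite, mul_one, mul_zero]

/-- evaluation of the octanomial. [cite: GrafVonBothmerEtAl2007, §3 (Prop. 7)] -/
private theorem eval_octanom (s t u v w y z x : K) :
    (X ^ d + s • X ^ m + t • X ^ n + u • X ^ l + v • X ^ j + w • X ^ g + y • X ^ e + z • X ^ c : K[X]).eval x =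
      x ^ d + s * x ^ m + t * x ^ n + u * x ^ l + v * x ^ j + w * x ^ g + y * x ^ e + z * x ^ c := by
  simp only [eval_add, eval_smul, eval_pow, eval_X, smul_eq_mul]

/-- evaluation of its `m`-th Hasse derivative. [cite: GrafVonBothmerEtAl2007, §3 (Prop. 7)] -/
private theorem eval_hasseDeriv_octanom_m (hce : c < e) (heg : e < g) (hgj : g < j) (hjl : j < l) (hln : l < n) (hnm : n < m) (s t u v w y z x : K) :
    (hasseDeriv m (X ^ d + s • X ^ m + t • X ^ n + u • X ^ l + v • X ^ j + w • X ^ g + y • X ^ e + z • X ^ c : K[X])).eval x =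
      (d.choose m : K) * x ^ (d - m) + s := by
  have hnm : n < m := hnm
  have hlm : l < m := lt_trans hln hnm
  have hjm : j < m := lt_trans hjl hlm
  have hgm : g < m := lt_trans hgj hjm
  have hem : e < m := lt_trans heg hgm
  have hcm : c < m := lt_trans hce hem
  simp only [map_add, map_smul, hasseDeriv_X_pow, eval_add, eval_smul, eval_mul, eval_C, eval_pow, eval_X, smul_eq_mul,
    Nat.choose_self, Nat.sub_self, pow_zero, mul_one, Nat.cast_one, Nat.choose_eq_zero_of_lt hnm, Nat.choose_eq_zero_of_lt hlm, Nat.choose_eq_zero_of_lt hjm, Nat.choose_eq_zero_of_lt hgm, Nat.choose_eq_zero_of_lt hem, Nat.choose_eq_zero_of_lt hcm, Nat.cast_zero, zero_mul,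
    mul_zero, add_zero]

/-- evaluation of its `n`-th Hasse derivative. [cite: GrafVonBothmerEtAl2007, §3 (Prop. 7)] -/
private theorem eval_hasseDeriv_octanom_n (hce : c < e) (heg : e < g) (hgj : g < j) (hjl : j < l) (hln : l < n) (s t u v w y z x : K) :
    (hasseDeriv n (X ^ d + s • X ^ m + t • X ^ n + u • X ^ l + v • X ^ j + w • X ^ g + y • X ^ e + z • X ^ c : K[X])).eval x =
      (d.choose n : K) * x ^ (d - n) + (m.choose n : K) * s * x ^ (m - n) + t := by
  have hln : l < n := hln
  have hjn : j < n := lt_trans hjl hln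
  have hgn : g < n := lt_trans hgj hjn
  have hen : e < n := lt_trans heg hgn
  have hcn : c < n := lt_trans hce hen
  simp only [map_add, map_smul, hasseDeriv_X_pow, eval_add, eval_smul, eval_mul, eval_C, eval_pow, eval_X, smul_eq_mul,
    Nat.choose_self, Nat.sub_self, pow_zero, mul_one, Nat.cast_one, Nat.choose_eq_zero_of_lt hln, Nat.choose_eq_zero_of_lt hjn, Nat.choose_eq_zero_of_lt hgn, Nat.choose_eq_zero_of_lt hen, Nat.choose_eq_zero_of_lt hcn, Nat.cast_zero, zero_mul,
    mul_zero, add_zero]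
  ring

/-- evaluation of its `l`-th Hasse derivative. [cite: GrafVonBothmerEtAl2007, §3 (Prop. 7)] -/
private theorem eval_hasseDeriv_octanom_l (hce : c < e) (heg : e < g) (hgj : g < j) (hjl : j < l) (s t u v w y z x : K) :
    (hasseDeriv l (X ^ d + s • X ^ m + t • X ^ n + u • X ^ l + v • X ^ j + w • X ^ g + y • X ^ e + z • X ^ c : K[X])).eval x =
      (d.choose l : K) * x ^ (d - l) + (m.choose l : K) * s * x ^ (m - l) + (n.choose l : K) * t * x ^ (n - l) + u := by
  have hjl : j < l := hjl
  have hgl : g < l := lt_trans hgj hjl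
  have hel : e < l := lt_trans heg hgl
  have hcl : c < l := lt_trans hce hel
  simp only [map_add, map_smul, hasseDeriv_X_pow, eval_add, eval_smul, eval_mul, eval_C, eval_pow, eval_X, smul_eq_mul,
    Nat.choose_self, Nat.sub_self, pow_zero, mul_one, Nat.cast_one, Nat.choose_eq_zero_of_lt hjl, Nat.choose_eq_zero_of_lt hgl, Nat.choose_eq_zero_of_lt hel, Nat.choose_eq_zero_of_lt hcl, Nat.cast_zero, zero_mul,
    mul_zero, add_zero]
  ring

/-- evaluation of its `j`-th Hasse derivative. [cite: GrafVonBothmerEtAl2007, §3 (Prop. 7)] -/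
private theorem eval_hasseDeriv_octanom_j (hce : c < e) (heg : e < g) (hgj : g < j) (s t u v w y z x : K) :
    (hasseDeriv j (X ^ d + s • X ^ m + t • X ^ n + u • X ^ l + v • X ^ j + w • X ^ g + y • X ^ e + z • X ^ c : K[X])).eval x =
      (d.choose j : K) * x ^ (d - j) + (m.choose j : K) * s * x ^ (m - j) + (n.choose j : K) * t * x ^ (n - j) + (l.choose j : K) * u * x ^ (l - j) + v := by
  have hgj : g < j := hgj
  have hej : e < j := lt_trans heg hgj
  have hcj : c < j := lt_trans hce hej
  simp only [map_add, map_smul, hasseDeriv_X_pow, eval_add, eval_smul, eval_mul, eval_C, eval_pow, eval_X, smul_eq_mul,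
    Nat.choose_self, Nat.sub_self, pow_zero, mul_one, Nat.cast_one, Nat.choose_eq_zero_of_lt hgj, Nat.choose_eq_zero_of_lt hej, Nat.choose_eq_zero_of_lt hcj, Nat.cast_zero, zero_mul,
    mul_zero, add_zero]
  ring

/-- evaluation of its `g`-th Hasse derivative. [cite: GrafVonBothmerEtAl2007, §3 (Prop. 7)] -/
private theorem eval_hasseDeriv_octanom_g (hce : c < e) (heg : e < g) (s t u v w y z x : K) :
    (hasseDeriv g (X ^ d + s • X ^ m + t • X ^ n + u • X ^ l + v • X ^ j + w • X ^ g + y • X ^ e + z • X ^ c : K[X])).eval x =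
      (d.choose g : K) * x ^ (d - g) + (m.choose g : K) * s * x ^ (m - g) + (n.choose g : K) * t * x ^ (n - g) + (l.choose g : K) * u * x ^ (l - g) + (j.choose g : K) * v * x ^ (j - g) + w := by
  have heg : e < g := heg
  have hcg : c < g := lt_trans hce heg
  simp only [map_add, map_smul, hasseDeriv_X_pow, eval_add, eval_smul, eval_mul, eval_C, eval_pow, eval_X, smul_eq_mul,
    Nat.choose_self, Nat.sub_self, pow_zero, mul_one, Nat.cast_one, Nat.choose_eq_zero_of_lt heg, Nat.choose_eq_zero_of_lt hcg, Nat.cast_zero, zero_mul,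
    mul_zero, add_zero]
  ring

/-- evaluation of its `e`-th Hasse derivative. [cite: GrafVonBothmerEtAl2007, §3 (Prop. 7)] -/
private theorem eval_hasseDeriv_octanom_e (hce : c < e) (s t u v w y z x : K) :
    (hasseDeriv e (X ^ d + s • X ^ m + t • X ^ n + u • X ^ l + v • X ^ j + w • X ^ g + y • X ^ e + z • X ^ c : K[X])).eval x =
      (d.choose e : K) * x ^ (d - e) + (m.choose e : K) * s * x ^ (m - e) + (n.choose e : K) * t * x ^ (n - e) + (l.choose e : K) * u * x ^ (l - e) + (j.choose e : K) * v * x ^ (j - e) + (g.choose e : K) * w * x ^ (g - e) + y := by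
  have hce : c < e := hce
  simp only [map_add, map_smul, hasseDeriv_X_pow, eval_add, eval_smul, eval_mul, eval_C, eval_pow, eval_X, smul_eq_mul,
    Nat.choose_self, Nat.sub_self, pow_zero, mul_one, Nat.cast_one, Nat.choose_eq_zero_of_lt hce, Nat.cast_zero, zero_mul,
    mul_zero, add_zero]
  ring

/-- evaluation of its `c`-th Hasse derivative. [cite: GrafVonBothmerEtAl2007, §3 (Prop. 7)] -/
private theorem eval_hasseDeriv_octanom_c (s t u v w y z x : K) :
    (hasseDeriv c (X ^ d + s • X ^ m + t • X ^ n + u • X ^ l + v • X ^ j + w • X ^ g + y • X ^ e + z • X ^ c : K[X])).eval x =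
      (d.choose c : K) * x ^ (d - c) + (m.choose c : K) * s * x ^ (m - c) + (n.choose c : K) * t * x ^ (n - c) + (l.choose c : K) * u * x ^ (l - c) + (j.choose c : K) * v * x ^ (j - c) + (g.choose c : K) * w * x ^ (g - c) + (e.choose c : K) * y * x ^ (e - c) + z := by
  simp only [map_add, map_smul, hasseDeriv_X_pow, eval_add, eval_smul, eval_mul, eval_C, eval_pow, eval_X, smul_eq_mul,
    Nat.choose_self, Nat.sub_self, pow_zero, mul_one, Nat.cast_one]
  ring

set_option maxHeartbeats 3200000 in
/-- **seven-witness criterion**: a centred octanomial with roots killing `H_m`, `H_n`, `H_l`, `H_j`, `H_g`, `H_e`, `H_c` is Casas-Alvero —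
the mechanism of the positive-characteristic counter-examples of [GvBLSW 2007, §3] (there `X^{p+1} - X^p`, Prop. 7), for sparse
centred polynomials with rational witnesses. [cite: GrafVonBothmerEtAl2007, §3 (Prop. 7)] -/
theorem isCasasAlvero_octanom (hc0 : 0 < c) (hce : c < e) (heg : e < g) (hgj : g < j) (hjl : j < l) (hln : l < n) (hnm : n < m) (hmd : m < d)
    {s t u v w y z ρ σ τ υ φ χ ψ : K}
    (hρf : (X ^ d + s • X ^ m + t • X ^ n + u • X ^ l + v • X ^ j + w • X ^ g + y • X ^ e + z • X ^ c : K[X]).eval ρ = 0)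
    (hρH : (hasseDeriv m (X ^ d + s • X ^ m + t • X ^ n + u • X ^ l + v • X ^ j + w • X ^ g + y • X ^ e + z • X ^ c : K[X])).eval ρ = 0)
    (hσf : (X ^ d + s • X ^ m + t • X ^ n + u • X ^ l + v • X ^ j + w • X ^ g + y • X ^ e + z • X ^ c : K[X]).eval σ = 0)
    (hσH : (hasseDeriv n (X ^ d + s • X ^ m + t • X ^ n + u • X ^ l + v • X ^ j + w • X ^ g + y • X ^ e + z • X ^ c : K[X])).eval σ = 0)
    (hτf : (X ^ d + s • X ^ m + t • X ^ n + u • X ^ l + v • X ^ j + w • X ^ g + y • X ^ e + z • X ^ c : K[X]).eval τ = 0)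
    (hτH : (hasseDeriv l (X ^ d + s • X ^ m + t • X ^ n + u • X ^ l + v • X ^ j + w • X ^ g + y • X ^ e + z • X ^ c : K[X])).eval τ = 0)
    (hυf : (X ^ d + s • X ^ m + t • X ^ n + u • X ^ l + v • X ^ j + w • X ^ g + y • X ^ e + z • X ^ c : K[X]).eval υ = 0)
    (hυH : (hasseDeriv j (X ^ d + s • X ^ m + t • X ^ n + u • X ^ l + v • X ^ j + w • X ^ g + y • X ^ e + z • X ^ c : K[X])).eval υ = 0)
    (hφf : (X ^ d + s • X ^ m + t • X ^ n + u • X ^ l + v • X ^ j + w • X ^ g + y • X ^ e + z • X ^ c : K[X]).eval φ = 0)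
    (hφH : (hasseDeriv g (X ^ d + s • X ^ m + t • X ^ n + u • X ^ l + v • X ^ j + w • X ^ g + y • X ^ e + z • X ^ c : K[X])).eval φ = 0)
    (hχf : (X ^ d + s • X ^ m + t • X ^ n + u • X ^ l + v • X ^ j + w • X ^ g + y • X ^ e + z • X ^ c : K[X]).eval χ = 0)
    (hχH : (hasseDeriv e (X ^ d + s • X ^ m + t • X ^ n + u • X ^ l + v • X ^ j + w • X ^ g + y • X ^ e + z • X ^ c : K[X])).eval χ = 0)
    (hψf : (X ^ d + s • X ^ m + t • X ^ n + u • X ^ l + v • X ^ j + w • X ^ g + y • X ^ e + z • X ^ c : K[X]).eval ψ = 0)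
    (hψH : (hasseDeriv c (X ^ d + s • X ^ m + t • X ^ n + u • X ^ l + v • X ^ j + w • X ^ g + y • X ^ e + z • X ^ c : K[X])).eval ψ = 0) :
    IsCasasAlvero (X ^ d + s • X ^ m + t • X ^ n + u • X ^ l + v • X ^ j + w • X ^ g + y • X ^ e + z • X ^ c : K[X]) := by
  intro i hi0 hi
  rw [natDegree_octanom hce heg hgj hjl hln hnm hmd] at hi
  by_cases him : i = m
  · subst him; exact ⟨ρ, hρf, hρH⟩
  by_cases hin : i = n
  · subst hin; exact ⟨σ, hσf, hσH⟩
  by_cases hil : i = l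
  · subst hil; exact ⟨τ, hτf, hτH⟩
  by_cases hij : i = j
  · subst hij; exact ⟨υ, hυf, hυH⟩
  by_cases hig : i = g
  · subst hig; exact ⟨φ, hφf, hφH⟩
  by_cases hie : i = e
  · subst hie; exact ⟨χ, hχf, hχH⟩
  by_cases hic : i = c
  · subst hic; exact ⟨ψ, hψf, hψH⟩
  apply sharesRoot_of_coeff_eq_zero
  · rw [eval_octanom, zero_pow (by omega), zero_pow (by omega), zero_pow (by omega), zero_pow (by omega), zero_pow (by omega), zero_pow (by omega), zero_pow (by omega), zero_pow (by omega)]; ring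
  · rw [coeff_octanom, if_neg (by omega), if_neg him, if_neg hin, if_neg hil, if_neg hij, if_neg hig, if_neg hie, if_neg hic]; ring

/-- a centred octanomial with `z ≠ 0` is not a pure `d`-th power. [cite: GrafVonBothmerEtAl2007, §3 (Prop. 7)] -/
theorem octanom_ne_pow (hc0 : 0 < c) (hce : c < e) (heg : e < g) (hgj : g < j) (hjl : j < l) (hln : l < n) (hnm : n < m) (hmd : m < d)
    {s t u v w y z : K} (hz : z ≠ 0) (a : K) :
    (X ^ d + s • X ^ m + t • X ^ n + u • X ^ l + v • X ^ j + w • X ^ g + y • X ^ e + z • X ^ c : K[X]) ≠ (X - C a) ^ d := by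
  intro h
  have h0 := congrArg (eval 0) h
  rw [eval_octanom, zero_pow (by omega), zero_pow (by omega), zero_pow (by omega), zero_pow (by omega), zero_pow (by omega), zero_pow (by omega), zero_pow (by omega), zero_pow (by omega)] at h0
  simp only [mul_zero, add_zero, eval_pow, eval_sub, eval_X, eval_C, zero_sub] at h0
  have ha : a = 0 := neg_eq_zero.mp ((pow_eq_zero_iff (by omega : d ≠ 0)).mp h0.symm)
  subst ha
  have hc := congrArg (fun q : K[X] => q.coeff c) h
  simp only [coeff_octanom, map_zero, sub_zero, coeff_X_pow, if_neg (by omega : ¬ c = d),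
    if_neg (by omega : ¬ c = m), if_neg (by omega : ¬ c = n), if_neg (by omega : ¬ c = l), if_neg (by omega : ¬ c = j), if_neg (by omega : ¬ c = g),
    if_neg (ne_of_lt hce), zero_add] at hc
  exact hz hc

/-- **octanomial refutation of `CA_d`**: fourteen identities in `K` and `z ≠ 0` give a Casas-Alvero polynomial of degree `d`
that is not a `d`-th power (a counter-example in the sense of [GvBLSW 2007, §3]). [cite: GrafVonBothmerEtAl2007, §3 (Prop. 7)] -/
theorem not_holdsInDegree_of_octanomial (hc0 : 0 < c) (hce : c < e) (heg : e < g) (hgj : g < j) (hjl : j < l) (hln : l < n) (hnm : n < m) (hmd : m < d)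
    {s t u v w y z : K} (hz : z ≠ 0) (ρ σ τ υ φ χ ψ : K)
    (h1 : ρ ^ d + s * ρ ^ m + t * ρ ^ n + u * ρ ^ l + v * ρ ^ j + w * ρ ^ g + y * ρ ^ e + z * ρ ^ c = 0)
    (h2 : (d.choose m : K) * ρ ^ (d - m) + s = 0)
    (h3 : σ ^ d + s * σ ^ m + t * σ ^ n + u * σ ^ l + v * σ ^ j + w * σ ^ g + y * σ ^ e + z * σ ^ c = 0)
    (h4 : (d.choose n : K) * σ ^ (d - n) + (m.choose n : K) * s * σ ^ (m - n) + t = 0)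
    (h5 : τ ^ d + s * τ ^ m + t * τ ^ n + u * τ ^ l + v * τ ^ j + w * τ ^ g + y * τ ^ e + z * τ ^ c = 0)
    (h6 : (d.choose l : K) * τ ^ (d - l) + (m.choose l : K) * s * τ ^ (m - l) + (n.choose l : K) * t * τ ^ (n - l) + u = 0)
    (h7 : υ ^ d + s * υ ^ m + t * υ ^ n + u * υ ^ l + v * υ ^ j + w * υ ^ g + y * υ ^ e + z * υ ^ c = 0)
    (h8 : (d.choose j : K) * υ ^ (d - j) + (m.choose j : K) * s * υ ^ (m - j) + (n.choose j : K) * t * υ ^ (n - j) + (l.choose j : K) * u * υ ^ (l - j) + v = 0)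
    (h9 : φ ^ d + s * φ ^ m + t * φ ^ n + u * φ ^ l + v * φ ^ j + w * φ ^ g + y * φ ^ e + z * φ ^ c = 0)
    (h10 : (d.choose g : K) * φ ^ (d - g) + (m.choose g : K) * s * φ ^ (m - g) + (n.choose g : K) * t * φ ^ (n - g) + (l.choose g : K) * u * φ ^ (l - g) + (j.choose g : K) * v * φ ^ (j - g) + w = 0)
    (h11 : χ ^ d + s * χ ^ m + t * χ ^ n + u * χ ^ l + v * χ ^ j + w * χ ^ g + y * χ ^ e + z * χ ^ c = 0)
    (h12 : (d.choose e : K) * χ ^ (d - e) + (m.choose e : K) * s * χ ^ (m - e) + (n.choose e : K) * t * χ ^ (n - e) + (l.choose e : K) * u * χ ^ (l - e) + (j.choose e : K) * v * χ ^ (j - e) + (g.choose e : K) * w * χ ^ (g - e) + y = 0)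
    (h13 : ψ ^ d + s * ψ ^ m + t * ψ ^ n + u * ψ ^ l + v * ψ ^ j + w * ψ ^ g + y * ψ ^ e + z * ψ ^ c = 0)
    (h14 : (d.choose c : K) * ψ ^ (d - c) + (m.choose c : K) * s * ψ ^ (m - c) + (n.choose c : K) * t * ψ ^ (n - c) + (l.choose c : K) * u * ψ ^ (l - c) + (j.choose c : K) * v * ψ ^ (j - c) + (g.choose c : K) * w * ψ ^ (g - c) + (e.choose c : K) * y * ψ ^ (e - c) + z = 0) :
    ¬ HoldsInDegree K d := by
  intro h
  have hCA : IsCasasAlvero (X ^ d + s • X ^ m + t • X ^ n + u • X ^ l + v • X ^ j + w • X ^ g + y • X ^ e + z • X ^ c : K[X]) :=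
    isCasasAlvero_octanom hc0 hce heg hgj hjl hln hnm hmd (by rw [eval_octanom]; exact h1)
      (by rw [eval_hasseDeriv_octanom_m hce heg hgj hjl hln hnm]; exact h2) (by rw [eval_octanom]; exact h3)
      (by rw [eval_hasseDeriv_octanom_n hce heg hgj hjl hln]; exact h4) (by rw [eval_octanom]; exact h5)
      (by rw [eval_hasseDeriv_octanom_l hce heg hgj hjl]; exact h6) (by rw [eval_octanom]; exact h7)
      (by rw [eval_hasseDeriv_octanom_j hce heg hgj]; exact h8) (by rw [eval_octanom]; exact h9)
      (by rw [eval_hasseDeriv_octanom_g hce heg]; exact h10) (by rw [eval_octanom]; exact h11)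
      (by rw [eval_hasseDeriv_octanom_e hce]; exact h12) (by rw [eval_octanom]; exact h13)
      (by rw [eval_hasseDeriv_octanom_c]; exact h14)
  obtain ⟨a, ha⟩ := h _ (monic_octanom hce heg hgj hjl hln hnm hmd s t u v w y z)
    (natDegree_octanom hce heg hgj hjl hln hnm hmd s t u v w y z) hCA
  exact octanom_ne_pow hc0 hce heg hgj hjl hln hnm hmd hz a ha

end Octanomial

end Literature.Algebra.Polynomial.CasasAlvero
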